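import Literature.NumberTheory.EllipticCurves.CasselsTateFiniteSupport
import Literature.NumberTheory.EllipticCurves.CasselsTateLevelAssembly
import Literature.NumberTheory.EllipticCurves.SelmerGaloisAction
import Literature.NumberTheory.GaloisCohomology.PoitouTate
import HarnessLib

/-!
# The levelwise Cassels–Tate inputs (local class field theory, Poitou–Tate, Milne I §6) — ONE named fact

Named literature fact (ONE `def … : Prop`, D-0014; no theorem, no `sorry`, no instance, no notation), filed by the BSD cell `bsd-stepL` (seat `bsd-stepL-shim3a`, planner ruling
g30 RULING 5 (b), 2026-08-27) so that the DISPLAYED duality inputs of the tree's transcription of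
Kolyvagin's ORDER argument (McCallum 1991 §§1, 5: `Summits/BirchSwinnertonDyer/Rank1Residual/X11b/KolyvaginShaOrderOfPoints.lean`,
`…/Three/KolyvaginShaOrderThree.lean`, `Summits/…/Theorems/ClassRecordThreeShimuraKolyvaginOrderBoundAtThreeSurjOrderShiftEnd.lean`,
`…/ErratumRoadFiveShimuraKolyvaginOrderBoundInertOrderEnd.lean`) enter route items BY NAME instead of
as raw hypotheses. Those machines take, at a level `q = p^{M₀}` (`p` odd, `M₀ ≥ 1`) and for a Weil-type
pairing `e : E[q²] × E[q²] → μ_{q²}`, a family of local invariant maps `inv = (inv_v)_v`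
(`Literature.NumberTheory.GaloisCohomology.LocalInvariants K (q·q)`, file `PoitouTate.lean` — the intended
inhabitant is the family of invariant isomorphisms of local class field theory) with: the reciprocity law
on `H²(K, μ_{q²})`, injectivity at the finite places, `Ш³(K, μ_{q²}) = 0`, the LEVEL-pairing property of
the tree's Cassels–Tate pairing `WeierstrassCurve.ctLevelPairing` (file `CasselsTateLevelAssembly.lean`,
Milne's Prop. 6.9 recipe) on `Ш(E/K)[q]`, and the `Gal(K/k)`-equivariance of its general-case value
`WeierstrassCurve.ctGeneralFun` (file `CasselsTateGeneralCase.lean`) on the `q²`-Selmer group. The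
present fact asserts, for every such datum, the EXISTENCE of a family with these five properties —
exactly as the tree's `poitouTate_sum_localTatePairing_eq_zero` ∕ `poitouTate_selmerStructure_duality`
(files `PoitouTate.lean`, `PoitouTateSelmerStructures.lean`) assert the existence of a family with the
Poitou–Tate properties; it REUSES their predicates `LocalInvariants.IsPerfect`,
`LocalInvariants.SumInvLocalizationEqZero` and the tree's `Literature.GroupTheory.FiniteAbelian.IsLevelPairing`
(file `GroupTheory/FiniteAbelian/LevelwisePairingAssembly.lean`) rather than restating them. Searched
before filing (`lean search`): no Literature `def` asserts (i)∕(iii)∕(iv)∕(v) below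
(`brauerHassePrinciple` is the injectivity half of Albert–Brauer–Hasse–Noether, not the reciprocity;
`WeierstrassCurve.exists_casselsTate_pairing` is the assembled all-levels pairing with no relation to
`ctLevelPairing`; `exists_casselsTate_pairing_of_inputs` is a THEOREM listing the tree's open inputs;
`poitouTate_sha_zmod_mu` ∕ `poitouTate_sha_tateDual` are `Ш¹`∕`Ш²` dualities).

## Sources (clause by clause)

* (i) **Reciprocity on `H²(K, μₙ)`** — `∑_v inv_v (loc_v c) = 0` for every global class `c` whose local
  invariants vanish off a finite set (`LocalInvariants.SumInvLocalizationEqZero`): the complex property of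
  the Albert–Brauer–Hasse–Noether sequence `0 → Br K → ⊕_v Br K_v → ℚ/ℤ → 0` restricted to
  `H²(K, μₙ) = Br(K)[n]`. Harari, *Galois Cohomology and Class Field Theory* (2020), Thm. 14.11 and
  Rem. 14.12; Neukirch–Schmidt–Wingberg (2008) Thm. 8.1.17; Milne, *ADT* (2006), I §4 (proof of 4.10) and
  App. A. [Harari2020] [NeukirchSchmidtWingberg2008] [MilneADT2006]
* (ii) **Local Tate duality at the finite places** (`LocalInvariants.IsPerfect`: `inv_v` bijective and
  `(a, b) ↦ inv_v (a ∪ b)` perfect on `H¹(K_v, M) × H¹(K_v, M^D)` for finite `n`-torsion `M`): Milne I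
  Cor. 2.3; Harari Prop. 8.13 and Thm. 10.9 — the same clause as in `poitouTate_sum_localTatePairing_eq_zero`.
* (iii) **`Ш³(K, μₙ) = 0`**: a class of `H³(K, μₙ)` vanishing at every place is `0`. Milne I Thm. 4.10(c):
  for `r ≥ 3`, `βʳ : Hʳ(G_S, M) → ⊕_{v real} Hʳ(K_v, M)` is an isomorphism (take `S` = all places).
* (iv) **The level pairing on `Ш(E/K)[q]`** (`IsLevelPairing q B`: `B` alternating and
  `(∀ y, B x y = 0) ↔ x ∈ qШ`): Milne I Prop. 6.9 (construction of the pairing `Ш(A) × Ш(A^t) → ℚ/ℤ` —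
  the tree's `ctLevelPairing` is that recipe at level `q` with the Weil pairing `e` and the family `inv`
  as data), Thm. 6.13(a) (the kernel on either side is the divisible subgroup) with Lemma 6.17 and the final
  diagram of its proof (level form `⟨a, Ш[q]⟩ = 0 ⇒ a ∈ qШ`; the converse is the first case of the
  definition), and, for alternation on an elliptic curve (principal polarisation from the `K`-rational
  point `O`), Thm. 6.13(b) ∕ Cassels 1962. The tree reduces (iv) to the Poitou–Tate exactness inputs
  `hPTc` (I 4.10(a) in cochain form), Lemma 6.15 (`h615`) and alternation (PROVED for odd `q`:
  `ctGeneralFun_self_eq_zero_of_odd`) in `isLevelPairing_ctLevelPairing_of_inputs`.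
  [MilneADT2006] [Cassels1962ArithmeticIV] [Tate1963DualityICM]
* (v) **`Gal(K/k)`-equivariance**: for `E` defined over the subfield `k` (the consumers: `k = ℚ`, `K`
  imaginary quadratic, `σ` = complex conjugation) and `σ ∈ Aut(K/k)`, the pairing is invariant under the
  action `conjAct W σ` of `σ` on `H¹(K, E[q²])` (file `SelmerGaloisAction.lean`; Gross 1991 §5 (5.1)):
  the canonicity of Milne's construction under the automorphism of `(K̄/k, E)` induced by a lift of `σ`.
  This is what Kolyvagin and McCallum USE when they split `Ш(E/K)_{p^∞}` and the Cassels pairing along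
  the eigenspaces of complex conjugation: McCallum 1991 §5 (p. 312 of the volume: "`Ш(E/K)^{−ε}_{p^∞} ≃
  (ℤ/p^{N₁})² × (ℤ/p^{N₃})² × ⋯` … since the pairing is skew-symmetric, the elementary divisors come in
  pairs"), Thm. 5.4 and Thm. 5.8 (eigenspace by eigenspace); Gross 1991 §5. [McCallumLMS1991] [GrossLMS1991]

## Rendering and quantifier shape (read by the referee: «levelwise ∃»)

For a number field `K`, a subfield datum `k` is fixed to `ℚ` (the only consumer shape; `conjAct` is
stated for `W : WeierstrassCurve ℚ` base-changed to `K`). For EVERY `E = W/ℚ` elliptic, EVERY odd prime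
power `q = p^{M₀}` (`M₀ ≥ 1`), EVERY involution datum `c ∈ Aut(K/ℚ)` (`c ≠ 1`, `c² = 1`; for the consumers
`K` is imaginary quadratic and `c` is complex conjugation) and EVERY Weil-type pairing `e` on `E[q²](K̄)`
(values `q²`-th roots of unity, bi-multiplicative, `Γ_K`-equivariant, alternating, non-degenerate — on
`E[q²] ≅ (ℤ/q²)²` such an `e` is a unit power of the Weil pairing `e_{q²}`, so (iv)∕(v) for `e` are
(iv)∕(v) for `e_{q²}` up to the unit) THERE EXISTS a family `inv : LocalInvariants K (q·q)` with (i)–(v).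
The `∃` is INSIDE all the `∀` (levelwise, per `(K, E, q, c, e)`): no uniform family is asserted. The
statement keeps every printed hypothesis the consumers can supply (`p` odd prime, `M₀ ≥ 1`, `e`
Weil-type) and nothing about the curve beyond `E/ℚ` elliptic.

## What this fact does NOT say

It does not assert finiteness of `Ш`, nor any bound, nor anything about a particular Selmer group; it
constructs nothing (the tree has no local class field theory: `LocalInvariants` is a bare family of
additive maps). DISCHARGING it (`casselsTate_levelInputs_holds`) = local class field theory (ii) + the
ABHN sequence (i) + Tate–Poitou (iii) + Milne I §6 for the tree's cochain recipe (iv) + its functoriality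
(v): size XL; no `_holds` is attempted. Consumers (cell `bsd-stepL`): the `p = 3` Shimura–Kolyvagin crux
`ShimuraKolyvaginOrderBoundAtThreeSurj` (`…Theorems/ClassRecordThreeShimuraKolyvaginOrderBoundAtThreeSurjHOfPrimitives.lean`,
binder `hCT` = this fact's body at `K`) and the `p ≥ 5` inert crux `ShimuraKolyvaginOrderBoundInertFromFive`
(S2 side, `…/ErratumRoadFiveShimuraKolyvaginOrderBoundInertS2OfCarrier.lean`).
-/

noncomputable section

universe u

namespace Literature.NumberTheory.EllipticCurves

open _root_.WeierstrassCurve Field NumberField IsDedekindDomain Function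
  Literature.NumberTheory.GaloisRepresentations Literature.NumberTheory.GaloisCohomology
open Literature.NumberTheory.GaloisRepresentations.DiscreteGaloisModule (mu MuCarrier)

section Fact

/-- **The levelwise Cassels–Tate inputs** (local class field theory + Poitou–Tate + Milne, *ADT*, I §6),
for a number field `K`: for every elliptic curve `E = W/ℚ`, every odd prime power `q = p^{M₀}` (`M₀ ≥ 1`),
every involution `c ∈ Aut(K/ℚ)` and every Weil-type pairing `e` on `E[q²](K̄)` (bi-multiplicative,
`Γ_K`-equivariant, alternating, non-degenerate, `q²`-th-root valued) there is a family of local invariant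
maps `inv_v : H²(K_v, μ_{q²}) → ℤ/q²` such that
(i) `∑_v inv_v (loc_v c) = 0` on global classes `c ∈ H²(K, μ_{q²})` (Albert–Brauer–Hasse–Noether;
Harari Thm. 14.11, Rem. 14.12; NSW Thm. 8.1.17) — `LocalInvariants.SumInvLocalizationEqZero`;
(ii) local Tate duality at the finite places, `inv_v` bijective (Milne I Cor. 2.3; Harari Prop. 8.13,
Thm. 10.9) — `LocalInvariants.IsPerfect`;
(iii) `Ш³(K, μ_{q²}) = 0`: a class of `H³(K, μ_{q²})` vanishing at every place is `0` (Milne I Thm. 4.10(c));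
(iv) Milne's Cassels–Tate pairing at level `q` built from `e` and `inv` (the tree's `ctLevelPairing`,
Milne I Prop. 6.9) is a LEVEL pairing on `Ш(E/K)[q]`: alternating, with kernel `Ш[q] ∩ qШ` (Milne I
Thm. 6.13(a) with Lemma 6.17; alternation Thm. 6.13(b) ∕ Cassels 1962) — `IsLevelPairing q`;
(v) its general-case value `ctGeneralFun` on the `q²`-Selmer group is invariant under the action
`conjAct W c` of `c` (Gross 1991 §5 (5.1); the equivariance used by McCallum 1991 §5, Thms. 5.4, 5.8 to
split `Ш(E/K)_{p^∞}` and the pairing along the eigenspaces of complex conjugation).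
See the module docstring for the quantifier shape (the `∃` is levelwise) and for what is NOT asserted.
[cite: MilneADT2006, Ch. I Cor. 2.3, Thm. 4.10(c), §6 Prop. 6.9, Thm. 6.13(a)(b), Lemma 6.17]
[cite: Harari2020, Prop. 8.13, Thm. 10.9, Thm. 14.11, Rem. 14.12] [cite: NeukirchSchmidtWingberg2008, Thm. (8.1.17)]
[cite: Cassels1962ArithmeticIV] [cite: Tate1963DualityICM] [cite: McCallumLMS1991, §5, Thm. 5.4, Thm. 5.8]
[cite: GrossLMS1991, §5 (5.1)] -/
def casselsTate_levelInputs (K : Type u) [Field K] [NumberField K] : Prop :=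
  ∀ (W : WeierstrassCurve ℚ) [W.IsElliptic] (p M₀ : ℕ), p.Prime → p ≠ 2 → 1 ≤ M₀ →
    ∀ [NeZero (p ^ M₀)] (c : K ≃ₐ[ℚ] K), c ≠ 1 → c * c = 1 →
    ∀ (e : geomTorsion (W.baseChange K) ((p ^ M₀ * p ^ M₀ : ℕ) : ℤ) →
        geomTorsion (W.baseChange K) ((p ^ M₀ * p ^ M₀ : ℕ) : ℤ) → AlgebraicClosure K)
      (hμ : ∀ S T, e S T ^ (p ^ M₀ * p ^ M₀) = 1)
      (hadd₁ : ∀ S₁ S₂ T, e (S₁ + S₂) T = e S₁ T * e S₂ T)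
      (hadd₂ : ∀ S T₁ T₂, e S (T₁ + T₂) = e S T₁ * e S T₂)
      (hgal : ∀ (σ : absoluteGaloisGroup K)
        (S T : geomTorsion (W.baseChange K) ((p ^ M₀ * p ^ M₀ : ℕ) : ℤ)), σ • e S T = e (σ • S) (σ • T))
      (halt : ∀ T, e T T = 1), (∀ T, (∀ S, e S T = 1) → T = 0) →
    ∃ (inv : LocalInvariants K (p ^ M₀ * p ^ M₀)) (hPT' : inv.SumInvLocalizationEqZero)
      (hH3 : ∀ x : galoisCohomology (mu K (p ^ M₀ * p ^ M₀)) 3,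
        (∀ v : Place K, galoisCohomology.localization (mu K (p ^ M₀ * p ^ M₀)) v 3 x = 0) → x = 0),
      inv.IsPerfect ∧
      Literature.GroupTheory.FiniteAbelian.IsLevelPairing (p ^ M₀)
        (ctLevelPairing (W.baseChange K) (p ^ M₀) e hμ hadd₁ hadd₂ hgal inv halt hPT' hH3
          (localTerm_finite_support (W := W.baseChange K) (m := p ^ M₀) (e := e) (hμ := hμ)
            (hadd₁ := hadd₁) (hadd₂ := hadd₂) (hgal := hgal) halt inv)) ∧
      (∀ z ∈ selmerGroup (W.baseChange K) ((p ^ M₀ * p ^ M₀ : ℕ) : ℤ),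
        ∀ t ∈ selmerGroup (W.baseChange K) ((p ^ M₀ * p ^ M₀ : ℕ) : ℤ),
        ctGeneralFun (W.baseChange K) (p ^ M₀) e hμ hadd₁ hadd₂ hgal inv
            (torsionH1ToH1 (W.baseChange K) _ (conjAct W c _ z))
            (torsionH1ToH1 (W.baseChange K) _ (conjAct W c _ t)) =
          ctGeneralFun (W.baseChange K) (p ^ M₀) e hμ hadd₁ hadd₂ hgal inv
            (torsionH1ToH1 (W.baseChange K) _ z) (torsionH1ToH1 (W.baseChange K) _ t))

end Fact

end Literature.NumberTheory.EllipticCurves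

end
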